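import Mathlib
import HarnessLib
import Summits.Ventures.LatticeQCDFlow.Exactness.NCMCGeneralSpaceAsymptoticVarianceLowerBound
import Summits.Ventures.LatticeQCDFlow.Exactness.NCMCGeneralSpaceRestartChainGammaCoverage

/-!
# The Green–Kubo variance along the restart chain is NEVER degenerate unless the observable is: `σ²_g ≥ (e/(2e+4)) Var_F g` for EVERY bounded record observable and EVERY protocol, so `σ²_w > 0 ↔ Var_F e^{−W} > 0` — deterministic or stochastic protocol, reversible level sampler or not

HONEST FRAMING: exact (Metropolis-corrected) sampling algorithms for lattice gauge theory;
figures of merit are autocorrelation/cost numbers at stated couplings and volumes; no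
continuum-physics claim.

Venture `LatticeQCDFlow` (cell pub-lqcd), topic `Exactness`; FANOUT row 13 (`eng-snf`, GEN-23).
NEW WORK of the cell, not a published result; no definition is introduced; nothing is cited as a
fact.  GEN-22's exact-coverage theorems for the Jarzynski / reweighting / BAR lanes along correlated
launches (`NCMCGeneralSpaceRestartChainGammaCoverage` and its successors) ASSUME `σ²_w > 0`;
GEN-22 discharged it for STOCHASTIC protocols (`NCMCGeneralSpaceRestartChainVarianceFloor`: a
conditional-variance floor) and for DETERMINISTIC protocols with a REVERSIBLE minorised level sampler
(`NCMCGeneralSpaceRestartChainStartObservable`), and listed "`σ²_w > 0` for deterministic protocols with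
non-reversible samplers" as NOT CLAIMED.  THIS file closes that item POSITIVELY and uniformly: the
restart chain `R = (κF ∘ₖ K).comap s` is minorised in ONE step by `m(Ω) · m̄`, `m̄ = (κF ∘ₘ m)/m(Ω)`
(GEN-18, `CrooksPair.restartKernel_nHit_one_minorised`), and GEN-20's
`greenKubo_variance_ge_of_minorised` (`NCMCGeneralSpaceAsymptoticVarianceLowerBound`: under
`κ(x, ·) ≥ ε ν`, `σ²_f ≥ (e/(2e + 4)) Var_π f` for EVERY bounded `f`) applies verbatim to `R` under
`P_F` — no structure of the protocol or of `K` beyond `ν₀`-invariance and `m ≤ K(z, ·)` enters.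
Conversely a `P_F`-a.s. constant observable has all autocovariances zero.  Hence the DICHOTOMY: the
asymptotic variance of the printed `dF` along correlated launches vanishes iff the weight `e^{−W}` is
`P_F`-a.s. equal to `Z₁/Z₀`, i.e. iff the protocol is almost surely exact — the only case in which no
error bar is needed.

## Content (Crooks pair, `Z₀ ≠ 0`; `K` Markov, `ν₀`-invariant, `m ≤ K(z, ·)` for all `z`, `m` finite,
## `m(Ω) ≠ 0`, `e = m(Ω).toReal`; `R = (κF ∘ₖ K).comap s`, `P_F = fwdPathLaw ν₀ κF`)

* `autocov_eq_zero_of_integral_sq_eq_zero`, `greenKubo_variance_eq_zero_of_integral_sq_eq_zero` —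
  any kernel / law: `∫ ḡ² dπ = 0` ⇒ every `C_ḡ(t) = 0` and `σ²_g = 0`;
  **`greenKubo_variance_pos_iff_of_minorised`** — one-step minorised chain: `0 < σ²_f ↔ 0 < Var_π f`.
* **`CrooksPair.variance_le_greenKubo_variance_restartChain`** — EVERY bounded measurable record
  observable `g`: `(e/(2e + 4)) ∫ (g − E_F g)² dP_F ≤ σ²_g`.
* **`CrooksPair.greenKubo_variance_restartChain_pos_iff`** — `0 < σ²_g ↔ 0 < ∫ (g − E_F g)² dP_F`;
  **`CrooksPair.greenKubo_variance_exp_neg_work_restartChain_pos_iff`** (`−B ≤ W`) —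
  `0 < σ²_w ↔ 0 < ∫ (e^{−W} − Z₁/Z₀)² dP_F`.
* **`CrooksPair.tendsto_measure_jarzynskiEstimate_mem_gammaInterval_restartChain_of_variance`** —
  GEN-22's printed-interval theorem with its hypothesis `σ²_w > 0` REPLACED by
  `0 < ∫ (e^{−W} − Z₁/Z₀)² dP_F` (the work is not `P_F`-a.s. equal to `ΔF`), every initial record law.

NOT CLAIMED: sharp constants; unbounded work; anything numerical.
-/

namespace Summit.Ventures.LatticeQCDFlow.Exactness.GeneralNCMC

open MeasureTheory ProbabilityTheory Set Filter Finset
open scoped ENNReal NNReal Topology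

/-! ## §1 Degenerate observables have zero autocovariances; the dichotomy for minorised chains -/

section Chain

variable {S : Type*} [MeasurableSpace S] {κ : Kernel S S} [IsMarkovKernel κ]
  {π : Measure S} [IsProbabilityMeasure π]

omit [IsMarkovKernel κ] in
/-- If `∫ ḡ² dπ = 0` for the centred bounded observable `ḡ = g − πg`, every stationary autocovariance
`C_ḡ(t) = ∫ ḡ · κ^t ḡ dπ` vanishes. -/
theorem autocov_eq_zero_of_integral_sq_eq_zero {g : S → ℝ} (hg : Measurable g) {C : ℝ}
    (hC : ∀ x, |g x| ≤ C) (h0 : ∫ y, (g y - ∫ z, g z ∂π) ^ 2 ∂π = 0) (t : ℕ) :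
    Scoring.autocov κ π (fun y => g y - ∫ z, g z ∂π) t = 0 := by
  obtain ⟨hgb, hCgb, -⟩ := Scoring.centred_observable_bounds π hg hC
  set gb : S → ℝ := fun y => g y - ∫ z, g z ∂π with hgbdef
  -- `ḡ² = 0` a.e., hence `ḡ = 0` a.e.
  have hsq_int : Integrable (fun y => gb y ^ 2) π :=
    Scoring.integrable_of_bounded π (hgb.pow_const 2) fun y => by
      rw [abs_pow]; exact pow_le_pow_left₀ (abs_nonneg _) (hCgb y) 2
  have hae2 : (fun y => gb y ^ 2) =ᵐ[π] 0 :=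
    (integral_eq_zero_iff_of_nonneg (fun y => sq_nonneg _) hsq_int).1 h0
  have hae : gb =ᵐ[π] 0 := by
    filter_upwards [hae2] with y hy
    simpa using hy
  -- the integrand of `C_ḡ(t)` vanishes a.e.
  unfold Scoring.autocov
  have hprod : (fun x => gb x * (Scoring.kop κ)^[t] gb x) =ᵐ[π] fun _ => 0 := by
    filter_upwards [hae] with x hx
    rw [hx, Pi.zero_apply, zero_mul]
  rw [integral_congr_ae hprod, integral_zero]

omit [IsMarkovKernel κ] in
/-- … hence the Green–Kubo variance `C_ḡ(0) + 2 Σ_{t≥1} C_ḡ(t)` vanishes. -/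
theorem greenKubo_variance_eq_zero_of_integral_sq_eq_zero {g : S → ℝ} (hg : Measurable g) {C : ℝ}
    (hC : ∀ x, |g x| ≤ C) (h0 : ∫ y, (g y - ∫ z, g z ∂π) ^ 2 ∂π = 0) :
    Scoring.autocov κ π (fun y => g y - ∫ z, g z ∂π) 0
      + 2 * ∑' t, Scoring.autocov κ π (fun y => g y - ∫ z, g z ∂π) (t + 1) = 0 := by
  simp only [autocov_eq_zero_of_integral_sq_eq_zero hg hC h0, tsum_zero, mul_zero, add_zero]

variable {ν : Measure S} [IsProbabilityMeasure ν] {ε : ℝ≥0∞}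

/-- **THE DICHOTOMY FOR A ONE-STEP MINORISED CHAIN**: `κ(z, ·) ≥ ε ν` (`ε ≠ 0`), `π` invariant,
`|f| ≤ C` measurable.  Then `0 < σ²_f ↔ 0 < Var_π f`. -/
theorem greenKubo_variance_pos_iff_of_minorised (hπ : Kernel.Invariant κ π) (hε : ε ≠ 0)
    (hmin : ∀ z, ε • ν ≤ κ z) {f : S → ℝ} (hf : Measurable f) {C : ℝ} (hC : ∀ x, |f x| ≤ C) :
    0 < Scoring.autocov κ π (fun y => f y - ∫ z, f z ∂π) 0
        + 2 * ∑' t, Scoring.autocov κ π (fun y => f y - ∫ z, f z ∂π) (t + 1)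
      ↔ 0 < ∫ y, (f y - ∫ z, f z ∂π) ^ 2 ∂π := by
  constructor
  · intro hσ
    rcases (integral_nonneg (μ := π) (f := fun y => (f y - ∫ z, f z ∂π) ^ 2)
      (fun y => sq_nonneg _)).lt_or_eq with hV | hV
    · exact hV
    · exact absurd (greenKubo_variance_eq_zero_of_integral_sq_eq_zero (κ := κ) hf hC hV.symm)
        hσ.ne'
  · intro hV
    haveI : Nonempty S := nonempty_of_isProbabilityMeasure π
    have hε1 : ε ≤ 1 := eps_le_one_of_minorised hmin
    have hεtop : ε ≠ ∞ := ne_top_of_le_ne_top ENNReal.one_ne_top hε1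
    have he : 0 < ε.toReal := ENNReal.toReal_pos hε hεtop
    have hfloor := greenKubo_variance_ge_of_minorised hπ hε hmin hf hC
    exact lt_of_lt_of_le (mul_pos (div_pos he (by positivity)) hV) hfloor

end Chain

/-! ## §2 The restart chain: every protocol, every minorised invariant level sampler -/

variable {Ω E : Type*} [MeasurableSpace Ω] [MeasurableSpace E]

namespace CrooksPair

variable {ν₀ ν₁ : Measure Ω} [IsFiniteMeasure ν₀] [IsFiniteMeasure ν₁] {κF κR : Kernel Ω E}
  [IsMarkovKernel κF] [IsMarkovKernel κR] {s e : E → Ω} {W : E → ℝ}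

omit [IsFiniteMeasure ν₁] [IsMarkovKernel κR] in
/-- **`(e/(2e + 4)) Var_F g ≤ σ²_g` ALONG THE RESTART CHAIN, EVERY BOUNDED RECORD OBSERVABLE.**  Crooks
pair with `Z₀ ≠ 0`; `K` Markov, `ν₀`-invariant, `m ≤ K(z, ·)` for all `z` (`m` finite, `m(Ω) ≠ 0`,
`e = m(Ω).toReal`); `g` measurable with `|g| ≤ C`.  No reversibility and no stochasticity of the
protocol is assumed. -/
theorem variance_le_greenKubo_variance_restartChain (K : Kernel Ω Ω) [IsMarkovKernel K]
    (h0 : ν₀ univ ≠ 0) (hK : Kernel.Invariant K ν₀) (h : CrooksPair ν₀ ν₁ κF κR s e W)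
    {m : Measure Ω} [IsFiniteMeasure m] (hm0 : m univ ≠ 0) (hmin : ∀ z, m ≤ K z)
    {g : E → ℝ} (hg : Measurable g) {C : ℝ} (hC : ∀ ω, |g ω| ≤ C) :
    (m univ).toReal / (2 * (m univ).toReal + 4)
        * ∫ ω, (g ω - ∫ z, g z ∂(fwdPathLaw ν₀ κF)) ^ 2 ∂(fwdPathLaw ν₀ κF)
      ≤ Scoring.autocov ((κF ∘ₖ K).comap s h.measurable_s) (fwdPathLaw ν₀ κF)
          (fun ω => g ω - ∫ z, g z ∂(fwdPathLaw ν₀ κF)) 0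
        + 2 * ∑' t, Scoring.autocov ((κF ∘ₖ K).comap s h.measurable_s) (fwdPathLaw ν₀ κF)
          (fun ω => g ω - ∫ z, g z ∂(fwdPathLaw ν₀ κF)) (t + 1) := by
  haveI := isProbabilityMeasure_fwdPathLaw ν₀ h0 κF
  haveI := isProbabilityMeasure_normalised_bind_kernel κF hm0
  have hmin1 : ∀ ω, m univ • ((m univ)⁻¹ • m.bind κF) ≤ ((κF ∘ₖ K).comap s h.measurable_s) ω :=
    fun ω => by
      have h1 := restartKernel_nHit_one_minorised K h hm0 hmin ω
      rwa [nHit_one] at h1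
  exact greenKubo_variance_ge_of_minorised (h.invariant_restartKernel K hK) hm0 hmin1 hg hC

omit [IsFiniteMeasure ν₁] [IsMarkovKernel κR] in
/-- **THE DICHOTOMY ALONG THE RESTART CHAIN**: for every bounded measurable record observable,
`0 < σ²_g ↔ 0 < ∫ (g − E_F g)² dP_F`. -/
theorem greenKubo_variance_restartChain_pos_iff (K : Kernel Ω Ω) [IsMarkovKernel K]
    (h0 : ν₀ univ ≠ 0) (hK : Kernel.Invariant K ν₀) (h : CrooksPair ν₀ ν₁ κF κR s e W)
    {m : Measure Ω} [IsFiniteMeasure m] (hm0 : m univ ≠ 0) (hmin : ∀ z, m ≤ K z)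
    {g : E → ℝ} (hg : Measurable g) {C : ℝ} (hC : ∀ ω, |g ω| ≤ C) :
    0 < Scoring.autocov ((κF ∘ₖ K).comap s h.measurable_s) (fwdPathLaw ν₀ κF)
          (fun ω => g ω - ∫ z, g z ∂(fwdPathLaw ν₀ κF)) 0
        + 2 * ∑' t, Scoring.autocov ((κF ∘ₖ K).comap s h.measurable_s) (fwdPathLaw ν₀ κF)
          (fun ω => g ω - ∫ z, g z ∂(fwdPathLaw ν₀ κF)) (t + 1)
      ↔ 0 < ∫ ω, (g ω - ∫ z, g z ∂(fwdPathLaw ν₀ κF)) ^ 2 ∂(fwdPathLaw ν₀ κF) := by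
  haveI := isProbabilityMeasure_fwdPathLaw ν₀ h0 κF
  haveI := isProbabilityMeasure_normalised_bind_kernel κF hm0
  have hmin1 : ∀ ω, m univ • ((m univ)⁻¹ • m.bind κF) ≤ ((κF ∘ₖ K).comap s h.measurable_s) ω :=
    fun ω => by
      have h1 := restartKernel_nHit_one_minorised K h hm0 hmin ω
      rwa [nHit_one] at h1
  exact greenKubo_variance_pos_iff_of_minorised (h.invariant_restartKernel K hK) hm0 hmin1 hg hC

omit [IsFiniteMeasure ν₁] in
/-- **`0 < σ²_w ↔ 0 < Var_F e^{−W}`** (`−B ≤ W`): the asymptotic variance of the Jarzynski lane along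
correlated launches is degenerate iff the weight is `P_F`-a.s. equal to `Z₁/Z₀` — whatever the protocol
(deterministic or stochastic) and the minorised `ν₀`-invariant level sampler (reversible or not). -/
theorem greenKubo_variance_exp_neg_work_restartChain_pos_iff (K : Kernel Ω Ω) [IsMarkovKernel K]
    (h0 : ν₀ univ ≠ 0) (hK : Kernel.Invariant K ν₀) (h : CrooksPair ν₀ ν₁ κF κR s e W)
    {m : Measure Ω} [IsFiniteMeasure m] (hm0 : m univ ≠ 0) (hmin : ∀ z, m ≤ K z)
    {B : ℝ} (hB : ∀ ω, -B ≤ W ω) :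
    0 < Scoring.autocov ((κF ∘ₖ K).comap s h.measurable_s) (fwdPathLaw ν₀ κF)
          (fun ω => Real.exp (-W ω) - ((ν₀ univ)⁻¹ * ν₁ univ).toReal) 0
        + 2 * ∑' t, Scoring.autocov ((κF ∘ₖ K).comap s h.measurable_s) (fwdPathLaw ν₀ κF)
          (fun ω => Real.exp (-W ω) - ((ν₀ univ)⁻¹ * ν₁ univ).toReal) (t + 1)
      ↔ 0 < ∫ ω, (Real.exp (-W ω) - ((ν₀ univ)⁻¹ * ν₁ univ).toReal) ^ 2 ∂(fwdPathLaw ν₀ κF) := by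
  have hC : ∀ ω, |Real.exp (-W ω)| ≤ Real.exp B := fun ω => by
    rw [abs_of_pos (Real.exp_pos _)]
    exact Real.exp_le_exp.2 (by linarith [hB ω])
  have key := h.greenKubo_variance_restartChain_pos_iff K h0 hK hm0 hmin
    (g := fun ω => Real.exp (-W ω)) (Real.measurable_exp.comp h.measurable_W.neg) hC
  rwa [h.integral_exp_neg_work] at key

/-! ## §3 The printed Jarzynski interval along correlated launches, with the variance hypothesis in
checkable form -/

/-- **THE PRINTED Γ-METHOD INTERVAL OF THE JARZYNSKI LANE IS ASYMPTOTICALLY EXACT WHENEVER THE WORK IS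
NOT `P_F`-a.s. EQUAL TO `ΔF`.**  GEN-22's
`tendsto_measure_jarzynskiEstimate_mem_gammaInterval_restartChain` with `σ²_w > 0` replaced by
`0 < ∫ (e^{−W} − Z₁/Z₀)² dP_F`; every initial record law `μ₀`. -/
theorem tendsto_measure_jarzynskiEstimate_mem_gammaInterval_restartChain_of_variance (K : Kernel Ω Ω)
    [IsMarkovKernel K] (h0 : ν₀ univ ≠ 0) (hK : Kernel.Invariant K ν₀)
    (h : CrooksPair ν₀ ν₁ κF κR s e W) {ΔF : ℝ}
    (hΔF : Real.exp (-ΔF) = ((ν₀ univ)⁻¹ * ν₁ univ).toReal) {m : Measure Ω} [IsFiniteMeasure m]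
    (hm0 : m univ ≠ 0) (hmin : ∀ z, m ≤ K z) {B : ℝ} (hB : ∀ ω, -B ≤ W ω)
    (hV : 0 < ∫ ω, (Real.exp (-W ω) - ((ν₀ univ)⁻¹ * ν₁ univ).toReal) ^ 2 ∂(fwdPathLaw ν₀ κF))
    {Wn : ℕ → ℕ} (hW : Tendsto Wn atTop atTop)
    (hW3 : Tendsto (fun n => (Wn n : ℝ) ^ 3 / n) atTop (𝓝 0)) {z : ℝ} (hz : 0 < z)
    (μ₀ : Measure E) [IsProbabilityMeasure μ₀]
    [IsProbabilityMeasure (Kernel.trajMeasure (X := fun _ : ℕ => E) μ₀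
        (fun n : ℕ => ((κF ∘ₖ K).comap s h.measurable_s).comap
          (fun hh : (j : ↥(Finset.Iic n)) → E => hh ⟨n, Finset.mem_Iic.2 le_rfl⟩)
          (measurable_pi_apply _)))] :
    Tendsto (fun n : ℕ => (Kernel.trajMeasure (X := fun _ : ℕ => E) μ₀
        (fun n : ℕ => ((κF ∘ₖ K).comap s h.measurable_s).comap
          (fun hh : (j : ↥(Finset.Iic n)) → E => hh ⟨n, Finset.mem_Iic.2 le_rfl⟩)
          (measurable_pi_apply _)))
        {ω : ℕ → E | |jarzynskiEstimate (fun ε => Real.exp (-W ε)) (fun i : Fin n => ω i) - ΔF|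
          ≤ z * Real.sqrt (Scoring.gammaHat (fun i => Real.exp (-W (ω i))) n 0
              * (2 * Scoring.tauIntWindow
                (Scoring.rhoHat (fun i => Real.exp (-W (ω i))) n) (Wn n)) / n)
            / sampleMean (fun ε => Real.exp (-W ε)) (fun i : Fin n => ω i)})
      atTop (𝓝 (gaussianReal 0 1 (Icc (-z) z))) :=
  h.tendsto_measure_jarzynskiEstimate_mem_gammaInterval_restartChain K h0 hK hΔF hm0 hmin hB
    ((h.greenKubo_variance_exp_neg_work_restartChain_pos_iff K h0 hK hm0 hmin hB).2 hV) hW hW3 hz μ₀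

end CrooksPair

end Summit.Ventures.LatticeQCDFlow.Exactness.GeneralNCMC
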